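import Summits.ABC.IUTFork.Thm311RealIsmDHMoverCriterion
import Literature.IUT.LogVolume.UnitLogBoundaryRamificationTrichotomy
import HarnessLib

/-!
# [IUTchIII] Cor. 3.12, TEAM R `indFixes` thread: the BALL-MOVER criterion at the BOUNDARY ramification
# index `e(v|p) = p − 1` — which balls `t·𝒪_v` Dupuy–Hilado's (Ind2) fixes and which it moves

PROOF-ONLY file (0 definitions, 0 named facts) of the abc-iut cell (block C / W6 prover seat abc-iut-w6-d060,
gen 2; TEAM R «ismDH mover» record support, the case left OPEN by abc-iut-w5-d044's general-`e` line
08:38Z «`e ≥ p − 1` … needs `log(𝒪^×)` beyond Prop 1.2 (i)'s equality clause»); TAKES NO SIDE on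
[IUTchIII] Cor. 3.12.

INPUTS BY NAME.  abc-iut-w5-d180's BALL-MOVER CRITERION (`Thm311RealIsmDHMoverCriterion`, p432150): at a finite
place `v | p` with the analytic logarithm, for `t ≠ 0`, EVERY `g ∈ Real.ismDH logv (inr v)` maps `t·𝒪_v` onto
itself iff `t·𝒪_v = p^k·log_p(𝒪_v^×)` for some `k ∈ ℤ`; its §5 evaluates `log_p(𝒪_v^×) = 𝔪_v` in the TAME
range `p > 2`, `e(v|p) ≤ p − 2` ([IUTchIV] Prop. 1.2 (i)).  The classical boundary computation
`Literature/IUT/LogVolume/UnitLogBoundaryRamification{,Roots,Trichotomy}` (this seat, p437144/p438002/p438664):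
at `e = p − 1`, `p` odd, for `K_v = F_v`, with `f = f(v|p)`:
(W1) no non-trivial `p`-th root of unity in `F_v` ⇒ `log_p(𝒪_v^×) = 𝔪_v`;
(W2) `ζ_p ∈ F_v`, `f = 1` ⇒ `log_p(𝒪_v^×) = 𝔪_v²`;
(W3) `ζ_p ∈ F_v`, `f ≥ 2` ⇒ no ball is a `ℚ_p^×`-multiple of `log_p(𝒪_v^×)`.

RESULTS (ns `Summit.ABC.IUTFork.Thm311.Real`, `e := e(v|p) = p − 1`, `p` odd, uniformizer `ϖ`, `j ∈ ℤ`):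
* (W1) `forall_ismDH_image_closedBall_eq_iff_dvd_of_boundary`: no `ζ_p ≠ 1` in `F_v` ⇒ the ball `𝔪_v^j` is
  (Ind2)-fixed **iff `e ∣ j − 1`** — the TAME CRITERION persists verbatim (`t·𝒪_v` moved iff
  `ord_v(t) ≢ 1 (mod e)`);
* (W2) `forall_ismDH_image_closedBall_eq_iff_dvd_two_of_boundary`: `ζ_p ∈ F_v`, `f(v|p) = 1` ⇒ `𝔪_v^j` is
  (Ind2)-fixed **iff `e ∣ j − 2`**; so at the place `(ζ_p − 1)` of `ℚ(ζ_p)`: for `p ≥ 5` the UNIT BALL `𝒪_v`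
  IS MOVED (`exists_mem_ismDH_image_unitBall_ne_of_boundary`), for `p = 3` it is fixed;
* (W3) `exists_mem_ismDH_image_closedBall_ne_of_boundary_of_two_le_inertiaDeg`: `ζ_p ∈ F_v`, `f(v|p) ≥ 2` ⇒
  **EVERY ball `t·𝒪_v`, `t ≠ 0`, is moved by some (Ind2)-element** (no parity condition at all).

HONEST FRAMING.  Statements about Dupuy–Hilado's typed (Ind2) group acting on one-factor hull-sets
([IUTchIII] Rmk. 3.9.5 (i)); which reading of [IUTchIII] Thm. 3.11 (i) (Ind2) is print's, and anything about
Cor. 3.12, is for the referee lanes / the R-lane record.  [cite: DupuyHilado2025, §4.9]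
[cite: WeilBNT1967, Ch. II §2, Th. 1–2] [cite: NeukirchANT1999, Ch. II Prop. (5.5)–(5.7)]
[cite: Washington1997, Lemma 1.4, §5.1] [claim: Mochizuki2012, status: disputed] for every [IUTchIII]/[IUTchIV]
locution.  Consumed BY NAME, nothing restated: `Real.ismDH`, `toR`/`ofR`, `forall_ismDH_iff_forall_latticeAut`,
`exists_basis_coe_logUnits_eq`, `exists_mem_ismDH_image_closedBall_ne_of_forall_ne` (w5-d180),
`PadicModule.forall_image_closedBall_eq_iff_of_coe_eq_closedBall`, `PadicModule.dvd_of_norm_zpow_eq_zpow`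
(campaign S), `RescaledCompletion`, `absRamificationIdx_rescaledCompletion`, `residueDegree_rescaledCompletion`
(abc-iut-S7), the trichotomy (this seat).
-/

noncomputable section

open Set Metric NumberField IsDedekindDomain
open scoped Pointwise

namespace Summit.ABC.IUTFork.Thm311.Real

open Cor312Vol Literature.IUT.LogThetaLattice Literature.IUT.LogVolume Literature.NumberTheory.NumberFields
open Literature.NumberTheory.GaloisRepresentations.Ultrametric

variable {F : Type} [Field F] [NumberField F] {p : ℕ} [hp : Fact p.Prime]
variable {logv : PadicLogs F} (hlog : LogvAnalyticAt p logv)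
variable {v : HeightOneSpectrum (𝓞 F)} {hv : ((p : ℕ) : 𝓞 F) ∈ v.asIdeal}

/-! ## 0. Radii: `‖ϖ‖^j = p^m·‖ϖ‖^{j₀}` for some `m` iff `e ∣ j − j₀` -/

omit hp in
/-- For a uniformizer `ϖ` of the completion (`‖ϖ‖^e = p⁻¹`): `‖ϖ^j‖ ∈ p^ℤ·‖ϖ^{j₀}‖` iff `e(v|p) ∣ j − j₀`.
[cite: NeukirchANT1999, Ch. II Prop. (5.5)] -/
theorem exists_norm_zpow_eq_zpow_mul_iff_dvd [Fact p.Prime] {ϖ : (RescaledCompletion F p v hv)ˣ}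
    (hϖ : IsUniformizer ϖ) (j j₀ : ℤ) :
    (∃ m : ℤ, ‖(ϖ : RescaledCompletion F p v hv) ^ j‖ =
        (p : ℝ) ^ m * ‖(ϖ : RescaledCompletion F p v hv) ^ j₀‖) ↔
      ((v.asIdeal.ramificationIdx ℤ : ℕ) : ℤ) ∣ (j - j₀) := by
  set K := RescaledCompletion F p v hv
  have heK : absRamificationIdx p K = v.asIdeal.ramificationIdx ℤ := absRamificationIdx_rescaledCompletion F p v hv
  have hn0 : ‖(ϖ : K)‖ ≠ 0 := norm_ne_zero_iff.2 ϖ.ne_zero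
  have hE := norm_pow_absRamificationIdx p K hϖ
  rw [← heK]
  constructor
  · rintro ⟨m, hm⟩
    rw [norm_zpow, norm_zpow] at hm
    have h1 : ‖(ϖ : K)‖ ^ (j - j₀) = (p : ℝ) ^ m := by
      rw [zpow_sub₀ hn0, hm, mul_div_assoc, div_self (zpow_ne_zero _ hn0), mul_one]
    exact PadicModule.dvd_of_norm_zpow_eq_zpow p hϖ h1
  · rintro ⟨q, hq⟩
    refine ⟨-q, ?_⟩
    rw [norm_zpow, norm_zpow, show j = (absRamificationIdx p K : ℤ) * q + j₀ by omega, zpow_add₀ hn0, zpow_mul,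
      zpow_natCast, hE, inv_zpow', zpow_neg]

section Boundary

include hlog

/-! ## (W1) No non-trivial `p`-th root of unity in `F_v`: the tame criterion persists -/

omit hlog in
/-- **(W1), evaluation**: at `e(v|p) = p − 1`, `p` odd, if `F_v` has NO non-trivial `p`-th root of unity then
`log_p(𝒪_v^×) = 𝔪_v = {‖y‖ ≤ ‖ϖ‖}` — as in the tame range. [cite: NeukirchANT1999, Ch. II Prop. (5.7)]
[cite: Washington1997, §5.1] -/
theorem logUnits_eq_closedBall_of_boundary (hp2 : p ≠ 2) (he : v.asIdeal.ramificationIdx ℤ = p - 1)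
    {ϖ : (RescaledCompletion F p v hv)ˣ} (hϖ : IsUniformizer ϖ)
    (hμ : ∀ ζ : RescaledCompletion F p v hv, ζ ^ p = 1 → ζ = 1) :
    logUnits (RescaledCompletion F p v hv) =
      closedBall (0 : RescaledCompletion F p v hv) ‖(ϖ : RescaledCompletion F p v hv)‖ := by
  have he' : absRamificationIdx p (RescaledCompletion F p v hv) = p - 1 := by
    rw [absRamificationIdx_rescaledCompletion]; exact he
  exact logUnits_eq_closedBall_of_forall_pow_prime_eq_one p hϖ he' hp2 hμ

/-- **(W1) BOUNDARY CRITERION without `ζ_p`.** At a place `v | p`, `p` odd, `e := e(v|p) = p − 1`, `F_v`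
without non-trivial `p`-th roots of unity: for a uniformizer `ϖ` and `j ∈ ℤ`, EVERY (Ind2)-element fixes
`𝔪_v^j = {‖y‖ ≤ ‖ϖ‖^j}` **iff `e ∣ (j − 1)`** — the tame criterion of abc-iut-w5-d180 (p432150 §5) verbatim.
[cite: DupuyHilado2025, §4.9] [cite: WeilBNT1967, Ch. II §2, Th. 2] [cite: NeukirchANT1999, Ch. II Prop. (5.7)] -/
theorem forall_ismDH_image_closedBall_eq_iff_dvd_of_boundary (hp2 : p ≠ 2)
    (he : v.asIdeal.ramificationIdx ℤ = p - 1) {ϖ : (RescaledCompletion F p v hv)ˣ} (hϖ : IsUniformizer ϖ)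
    (hμ : ∀ ζ : RescaledCompletion F p v hv, ζ ^ p = 1 → ζ = 1) (j : ℤ) :
    (∀ g ∈ ismDH logv (.inr v),
        (fun a => toR p v hv (g (ofR p v hv a))) ''
            closedBall (0 : RescaledCompletion F p v hv) ‖(ϖ : RescaledCompletion F p v hv) ^ j‖ =
          closedBall 0 ‖(ϖ : RescaledCompletion F p v hv) ^ j‖) ↔
      ((v.asIdeal.ramificationIdx ℤ : ℕ) : ℤ) ∣ (j - 1) := by
  set K := RescaledCompletion F p v hv
  obtain ⟨n, hn, B, hΛ⟩ := exists_basis_coe_logUnits_eq (p := p) v hv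
  have hball : (PadicModule.basisLattice p B : Set K) = closedBall 0 ‖(ϖ : K) ^ (1 : ℤ)‖ := by
    rw [← hΛ, logUnits_eq_closedBall_of_boundary hp2 he hϖ hμ, zpow_one]
  have hϖ0 : (ϖ : K) ^ j ≠ 0 := zpow_ne_zero _ ϖ.ne_zero
  rw [forall_ismDH_iff_forall_latticeAut hlog B hΛ fun ψ => ψ '' closedBall (0 : K) ‖(ϖ : K) ^ j‖ =
      closedBall 0 ‖(ϖ : K) ^ j‖,
    PadicModule.forall_image_closedBall_eq_iff_of_coe_eq_closedBall p B hball hϖ0]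
  exact exists_norm_zpow_eq_zpow_mul_iff_dvd hϖ j 1

/-- **(W1), mover form**: `F_v` without `ζ_p ≠ 1`, `e(v|p) = p − 1`, `t ≠ 0` of order `j` with `e ∤ (j − 1)`:
some (Ind2)-element MOVES `t·𝒪_v`. [cite: DupuyHilado2025, §4.9] [cite: WeilBNT1967, Ch. II §2, Th. 2] -/
theorem exists_mem_ismDH_image_closedBall_ne_of_boundary (hp2 : p ≠ 2)
    (he : v.asIdeal.ramificationIdx ℤ = p - 1) {ϖ : (RescaledCompletion F p v hv)ˣ} (hϖ : IsUniformizer ϖ)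
    (hμ : ∀ ζ : RescaledCompletion F p v hv, ζ ^ p = 1 → ζ = 1) {t : RescaledCompletion F p v hv} {j : ℤ}
    (ht : ‖t‖ = ‖(ϖ : RescaledCompletion F p v hv)‖ ^ j)
    (hj : ¬ ((v.asIdeal.ramificationIdx ℤ : ℕ) : ℤ) ∣ (j - 1)) :
    ∃ g ∈ ismDH logv (.inr v),
      (fun a => toR p v hv (g (ofR p v hv a))) '' closedBall (0 : RescaledCompletion F p v hv) ‖t‖ ≠
        closedBall 0 ‖t‖ := by
  by_contra h
  push Not at h
  rw [ht, ← norm_zpow] at h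
  exact hj ((forall_ismDH_image_closedBall_eq_iff_dvd_of_boundary hlog hp2 he hϖ hμ j).1 h)

/-! ## (W2) `ζ_p ∈ F_v`, `f(v|p) = 1`: fixed iff `e ∣ j − 2` -/

omit hlog in
/-- **(W2), evaluation**: at `e(v|p) = p − 1`, `p` odd, `f(v|p) = 1`, with a non-trivial `p`-th root of unity
`ζ ∈ F_v` (so `F_v ≅ ℚ_p(ζ_p)`): `log_p(𝒪_v^×) = 𝔪_v² = {‖y‖ ≤ ‖ϖ‖²}`. [cite: Washington1997, Lemma 1.4, §5.1]
[cite: NeukirchANT1999, Ch. II Prop. (5.7)] -/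
theorem logUnits_eq_closedBall_sq_of_boundary (hp2 : p ≠ 2) (he : v.asIdeal.ramificationIdx ℤ = p - 1)
    (hf : v.asIdeal.inertiaDeg ℤ = 1) {ϖ : (RescaledCompletion F p v hv)ˣ} (hϖ : IsUniformizer ϖ)
    {ζ : RescaledCompletion F p v hv} (hζ : ζ ^ p = 1) (hζ1 : ζ ≠ 1) :
    logUnits (RescaledCompletion F p v hv) =
      closedBall (0 : RescaledCompletion F p v hv) (‖(ϖ : RescaledCompletion F p v hv)‖ ^ 2) := by
  have he' : absRamificationIdx p (RescaledCompletion F p v hv) = p - 1 := by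
    rw [absRamificationIdx_rescaledCompletion]; exact he
  have hf' : residueDegree p (RescaledCompletion F p v hv) = 1 := by
    rw [residueDegree_rescaledCompletion]; exact hf
  exact logUnits_eq_closedBall_sq_of_residueDegree_eq_one p hϖ he' hp2 hζ hζ1 hf'

/-- **(W2) BOUNDARY CRITERION with `ζ_p`, `f = 1`.** At a place `v | p`, `p` odd, `e := e(v|p) = p − 1`,
`f(v|p) = 1`, `ζ_p ∈ F_v` (i.e. `F_v ≅ ℚ_p(ζ_p)`): for a uniformizer `ϖ` and `j ∈ ℤ`, EVERY (Ind2)-element fixes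
`𝔪_v^j` **iff `e ∣ (j − 2)`** — the ball `t·𝒪_v` is MOVED iff `ord_v(t) ≢ 2 (mod p − 1)`.
[cite: DupuyHilado2025, §4.9] [cite: WeilBNT1967, Ch. II §2, Th. 2] [cite: Washington1997, §5.1] -/
theorem forall_ismDH_image_closedBall_eq_iff_dvd_two_of_boundary (hp2 : p ≠ 2)
    (he : v.asIdeal.ramificationIdx ℤ = p - 1) (hf : v.asIdeal.inertiaDeg ℤ = 1)
    {ϖ : (RescaledCompletion F p v hv)ˣ} (hϖ : IsUniformizer ϖ)
    {ζ : RescaledCompletion F p v hv} (hζ : ζ ^ p = 1) (hζ1 : ζ ≠ 1) (j : ℤ) :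
    (∀ g ∈ ismDH logv (.inr v),
        (fun a => toR p v hv (g (ofR p v hv a))) ''
            closedBall (0 : RescaledCompletion F p v hv) ‖(ϖ : RescaledCompletion F p v hv) ^ j‖ =
          closedBall 0 ‖(ϖ : RescaledCompletion F p v hv) ^ j‖) ↔
      ((v.asIdeal.ramificationIdx ℤ : ℕ) : ℤ) ∣ (j - 2) := by
  set K := RescaledCompletion F p v hv
  obtain ⟨n, hn, B, hΛ⟩ := exists_basis_coe_logUnits_eq (p := p) v hv
  have hball : (PadicModule.basisLattice p B : Set K) = closedBall 0 ‖(ϖ : K) ^ (2 : ℤ)‖ := by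
    rw [← hΛ, logUnits_eq_closedBall_sq_of_boundary hp2 he hf hϖ hζ hζ1, norm_zpow, zpow_ofNat]
  have hϖ0 : (ϖ : K) ^ j ≠ 0 := zpow_ne_zero _ ϖ.ne_zero
  rw [forall_ismDH_iff_forall_latticeAut hlog B hΛ fun ψ => ψ '' closedBall (0 : K) ‖(ϖ : K) ^ j‖ =
      closedBall 0 ‖(ϖ : K) ^ j‖,
    PadicModule.forall_image_closedBall_eq_iff_of_coe_eq_closedBall p B hball hϖ0]
  exact exists_norm_zpow_eq_zpow_mul_iff_dvd hϖ j 2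

/-- **(W2), mover form**: `ζ_p ∈ F_v`, `f = 1`, `e = p − 1`, `t ≠ 0` of order `j` with `e ∤ (j − 2)`: some
(Ind2)-element MOVES `t·𝒪_v`. [cite: DupuyHilado2025, §4.9] [cite: WeilBNT1967, Ch. II §2, Th. 2] -/
theorem exists_mem_ismDH_image_closedBall_ne_of_boundary_of_inertiaDeg_eq_one (hp2 : p ≠ 2)
    (he : v.asIdeal.ramificationIdx ℤ = p - 1) (hf : v.asIdeal.inertiaDeg ℤ = 1)
    {ϖ : (RescaledCompletion F p v hv)ˣ} (hϖ : IsUniformizer ϖ)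
    {ζ : RescaledCompletion F p v hv} (hζ : ζ ^ p = 1) (hζ1 : ζ ≠ 1) {t : RescaledCompletion F p v hv} {j : ℤ}
    (ht : ‖t‖ = ‖(ϖ : RescaledCompletion F p v hv)‖ ^ j)
    (hj : ¬ ((v.asIdeal.ramificationIdx ℤ : ℕ) : ℤ) ∣ (j - 2)) :
    ∃ g ∈ ismDH logv (.inr v),
      (fun a => toR p v hv (g (ofR p v hv a))) '' closedBall (0 : RescaledCompletion F p v hv) ‖t‖ ≠
        closedBall 0 ‖t‖ := by
  by_contra h
  push Not at h
  rw [ht, ← norm_zpow] at h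
  exact hj ((forall_ismDH_image_closedBall_eq_iff_dvd_two_of_boundary hlog hp2 he hf hϖ hζ hζ1 j).1 h)

/-- **(W2), the unit ball**: `ζ_p ∈ F_v`, `f(v|p) = 1`, `e(v|p) = p − 1` and **`p ≥ 5`**: the UNIT BALL `𝒪_v`
(the one-factor `q`-pilot hull-set at a place where `q` is a unit) IS MOVED by some (Ind2)-element
(`e = p − 1 ≥ 4` does not divide `0 − 2`).  E.g. the place `(ζ_5 − 1)` of `ℚ(ζ_5)` — abc-iut-w5-d044's
08:38Z example «places over 5 of `F ∋ ζ_5`» (for `p = 3`, `e = 2 ∣ −2`: `𝒪_v` is fixed at `(ζ_3 − 1)` of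
`ℚ(ζ_3)`, consistent with the cell's ζ₃ files). [cite: DupuyHilado2025, §4.9] [cite: Washington1997, §5.1] -/
theorem exists_mem_ismDH_image_unitBall_ne_of_boundary (h5 : 5 ≤ p)
    (he : v.asIdeal.ramificationIdx ℤ = p - 1) (hf : v.asIdeal.inertiaDeg ℤ = 1)
    {ζ : RescaledCompletion F p v hv} (hζ : ζ ^ p = 1) (hζ1 : ζ ≠ 1) :
    ∃ g ∈ ismDH logv (.inr v),
      (fun a => toR p v hv (g (ofR p v hv a))) '' closedBall (0 : RescaledCompletion F p v hv) 1 ≠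
        closedBall 0 1 := by
  obtain ⟨ϖ, hϖ, -⟩ := exists_isUniformizer_rescaledCompletion F p v hv
  have h1 : ‖(1 : RescaledCompletion F p v hv)‖ = ‖(ϖ : RescaledCompletion F p v hv)‖ ^ (0 : ℤ) := by
    rw [norm_one, zpow_zero]
  have h := exists_mem_ismDH_image_closedBall_ne_of_boundary_of_inertiaDeg_eq_one hlog (by omega) he hf hϖ
    hζ hζ1 h1 (by
      rw [he, zero_sub]
      intro hd
      have h2 : ((p - 1 : ℕ) : ℤ) ∣ 2 := (dvd_neg.mpr hd)
      have h3 : (p - 1 : ℕ) ∣ 2 := by exact_mod_cast h2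
      have h4 := Nat.le_of_dvd two_pos h3
      omega)
  rwa [norm_one] at h

/-! ## (W3) `ζ_p ∈ F_v`, `f(v|p) ≥ 2`: EVERY ball is moved -/

/-- **(W3) BOUNDARY MOVER, `f ≥ 2`.** At a place `v | p`, `p` odd, `e(v|p) = p − 1`, `f(v|p) ≥ 2`, with a
non-trivial `p`-th root of unity in `F_v`: `log_p(𝒪_v^×)` is no `𝒪_v`-module, so NO ball `t·𝒪_v` is
`p^k·log_p(𝒪_v^×)`, and therefore **EVERY ball `t·𝒪_v` (`t ≠ 0`) is MOVED by some (Ind2)-element** — no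
congruence condition on `ord_v(t)` at all. [cite: DupuyHilado2025, §4.9] [cite: WeilBNT1967, Ch. II §2, Th. 1–2]
[cite: Washington1997, Lemma 1.4, §5.1] -/
theorem exists_mem_ismDH_image_closedBall_ne_of_boundary_of_two_le_inertiaDeg (hp2 : p ≠ 2)
    (he : v.asIdeal.ramificationIdx ℤ = p - 1) (hf : 2 ≤ v.asIdeal.inertiaDeg ℤ)
    {ζ : RescaledCompletion F p v hv} (hζ : ζ ^ p = 1) (hζ1 : ζ ≠ 1) {t : RescaledCompletion F p v hv}
    (ht : t ≠ 0) :
    ∃ g ∈ ismDH logv (.inr v),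
      (fun a => toR p v hv (g (ofR p v hv a))) '' closedBall (0 : RescaledCompletion F p v hv) ‖t‖ ≠
        closedBall 0 ‖t‖ := by
  obtain ⟨ϖ, hϖ, -⟩ := exists_isUniformizer_rescaledCompletion F p v hv
  have he' : absRamificationIdx p (RescaledCompletion F p v hv) = p - 1 := by
    rw [absRamificationIdx_rescaledCompletion]; exact he
  have hf' : 2 ≤ residueDegree p (RescaledCompletion F p v hv) := by
    rw [residueDegree_rescaledCompletion]; exact hf
  refine exists_mem_ismDH_image_closedBall_ne_of_forall_ne hlog v hv ht fun k => ?_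
  exact closedBall_ne_smul_logUnits p hϖ he' hp2 hζ hζ1 hf' ‖t‖
    (zpow_ne_zero k (Nat.cast_ne_zero.mpr hp.out.ne_zero))

end Boundary

/-! ## Roots of unity of `F` give roots of unity of `F_v` -/

omit hp in
/-- A non-trivial `p`-th root of unity of the number field `F` is one of every completion `F_v` (the field map
`F → F_v` is injective), so the hypotheses «`ζ ∈ F_v`, `ζ^p = 1`, `ζ ≠ 1`» of (W2)/(W3) hold at every `v | p`
as soon as `ζ_p ∈ F`. [cite: NeukirchANT1999, Ch. II §5] -/
theorem exists_pow_eq_one_ne_one_rescaledCompletion [Fact p.Prime] {ζ : F} (hζ : ζ ^ p = 1) (hζ1 : ζ ≠ 1) :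
    ∃ ζ' : RescaledCompletion F p v hv, ζ' ^ p = 1 ∧ ζ' ≠ 1 := by
  refine ⟨RescaledCompletion.of F p v hv (algebraMap F (v.adicCompletion F) ζ), ?_, ?_⟩
  · rw [← map_pow, ← map_pow, hζ, map_one, map_one]
  · intro h
    apply hζ1
    have h1 : algebraMap F (v.adicCompletion F) ζ = 1 := by
      have := congrArg (RescaledCompletion.of F p v hv).symm h
      rwa [RingEquiv.symm_apply_apply, map_one] at this
    exact (algebraMap F (v.adicCompletion F)).injective (by rw [h1, map_one])

end Summit.ABC.IUTFork.Thm311.Real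

end
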